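import Summits.ABC.StewartYu.PadicG3TwoBudgetT
import Summits.ABC.StewartYu.PadicG3TwoFirstBranch
import HarnessLib

/-!
# Cell abc-stewartyu, Gen-3 frame at `p = 2` (crux `Y07Two`, stmt-ABC-19659), closer glue: ONE smallness exponent
# for every `‖Λ₀‖`-branch of the schedule of record `schedTwoS`

`Summits/ABC/StewartYu/PadicG3TwoFirstExp.lean` — cell `abc-stewartyu` (HOME `run/shared/lean/pub/abc-stewartyu/`),
route `PadicPrimesKummerThird`, seat p3 (g6, F-two lead).  Theorems only (natural-number arithmetic).

The `‖Λ₀‖`-branch of a k-step (third step) is below its gain branch as soon as `‖Λ₀‖ ≤ 2^{−e}` with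
`e = t + condExp 2 (2N+1) t + (m+2)·g` (`PadicG3TwoFirstBranch.first_le_gain`).  With `condExp 2 M t ≤
t·(M + log₂ 2M) ≤ 3·M·t` (`condExp_two_le`, `log₂ x ≤ x`) and `g ≤ (2N+1)·t` every such exponent is `≤ (m+6)·(2N+1)·t`
(`first_exp_le`), and along `schedTwoS` the products `(2N+1)·t` are UNIFORMLY bounded: `(2·Nsub3 I k + 1)·T3 I ≤
3^{d+5}·X·L` (`Xs3 I·(T3 I + 1) ≤ 4XL`, `k ≤ d + 2`) and `(2·Nfin I + 1)·t₃ ≤ (d+3)·3^{d+5}·X·L` (`t₃ ≤ (d+3)·T3 I`).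
Hence the single exponent **`(m+6)·(d+3)·3^{d+5}·X·L`** dominates every first-branch exponent of (L2₀)/(L2)/(L3ᴿ):
`kExpA_schedTwoS_le`, `kExp_schedTwoS_le`, `tExp_schedTwoS_le` — the closer asks the negated bound for
`‖Λ₀‖ ≤ 2^{−(that + m + 3)}` once.

WHAT THIS IS NOT: the comparison of that exponent with the crux threshold (headline); no crux moves.

References: K. Yu, Acta Math. 211 (2013), Lemma 5.1, (5.19); K. Yu, Compositio Math. 74 (1990), §3.
-/

noncomputable section

open Finset
open Literature.NumberTheory.Transcendental
open Literature.NumberTheory.Transcendental.CW77.Setup (Tau tauNorm)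
open Literature.NumberTheory.Transcendental.PadicCW77 (condExp)

namespace Summit.ABC.StewartYu

namespace TwoSetup

open Summit.ABC.StewartYu.G3Boxes Summit.ABC.StewartYu.PadicG3Par

/-- **One exponent from the node–multiplicity product**: `t + condExp 2 (2N+1) t + (m+2)·g ≤ (m+6)·B` when
`g ≤ (2N+1)·t ≤ B`. [cite: Yu1990, §3; shape only] -/
theorem first_exp_le {N t g m B : ℕ} (hg : g ≤ (2 * N + 1) * t) (hB : (2 * N + 1) * t ≤ B) :
    t + condExp 2 (2 * N + 1) t + (m + 2) * g ≤ (m + 6) * B := by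
  have hc := condExp_two_le (2 * N + 1) t
  have hlog : Nat.log 2 (2 * (2 * N + 1)) ≤ 2 * (2 * N + 1) := Nat.log_le_self _ _
  have h1 : condExp 2 (2 * N + 1) t ≤ 3 * ((2 * N + 1) * t) := by
    calc condExp 2 (2 * N + 1) t ≤ t * (2 * N + 1 + Nat.log 2 (2 * (2 * N + 1))) := hc
      _ ≤ t * (2 * N + 1 + 2 * (2 * N + 1)) := Nat.mul_le_mul_left _ (by omega)
      _ = 3 * ((2 * N + 1) * t) := by ring
  have h2 : t ≤ (2 * N + 1) * t := Nat.le_mul_of_pos_left t (by omega)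
  have h3 : (m + 2) * g ≤ (m + 2) * B := Nat.mul_le_mul_left _ (hg.trans hB)
  nlinarith

variable (S : TwoSetup) (P : PadicG3Par (S.d + 1))

/-- `Xs3 I · (T3 I + 1) ≤ 4·X·L` (natural numbers). [folklore] -/
theorem Xs3_mul_le_nat (I : ℕ) : S.Xs3 P I * (S.T3 P I + 1) ≤ 4 * P.X * P.L := by
  unfold Xs3; exact Nat.div_mul_le_self _ _

/-- `Nsub3 I k ≤ 3^{k+1}·Xs3 I` (at `(0,0)`: `X ≤ 3·Xs3 0`). [folklore] -/
theorem Nsub3_le (I k : ℕ) : S.Nsub3 P I k ≤ 3 ^ (k + 1) * S.Xs3 P I := by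
  unfold Nsub3
  split_ifs with hk hI
  · subst hk; subst hI
    have h := S.Xs3_zero_ge P
    have hX : (0:ℝ) ≤ P.X := by positivity
    have : (P.X : ℝ) ≤ 3 * (S.Xs3 P 0 : ℝ) := by linarith
    rw [pow_one]; exact_mod_cast this
  · subst hk; rw [zero_add, pow_one]
  · rw [pow_succ]
    calc 3 ^ k * S.Xs3 P I = 3 ^ k * 1 * S.Xs3 P I := by ring
      _ ≤ 3 ^ k * 3 * S.Xs3 P I := by gcongr; norm_num

/-- **The node–multiplicity product of every k-step**: `(2·Nsub3 I k + 1)·T3 I ≤ 3^{d+5}·X·L` (`k ≤ d + 2`,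
`X ≥ 1`). [cite: Nesterenko2003, §4 (4.3); shape only] -/
theorem nodes_mul_T3_le (I : ℕ) {k : ℕ} (hk : k ≤ S.d + 2) :
    (2 * S.Nsub3 P I k + 1) * S.T3 P I ≤ 3 ^ (S.d + 5) * (P.X * P.L) := by
  have hN := S.Nsub3_le P I k
  have hXT := S.Xs3_mul_le_nat P I
  have hX : 1 ≤ P.X := le_trans (by norm_num) P.seventytwo_le_X'
  have h3 : 3 ^ (k + 1) ≤ 3 ^ (S.d + 3) := Nat.pow_le_pow_right (by norm_num) (by omega)
  have hXs : S.Xs3 P I * S.T3 P I ≤ 4 * P.X * P.L := le_trans (Nat.mul_le_mul_left _ (Nat.le_succ _)) hXT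
  have hT : S.T3 P I ≤ 4 * P.L := by unfold T3; exact Nat.div_le_self _ _
  have e : 3 ^ (S.d + 5) = 9 * 3 ^ (S.d + 3) := by rw [pow_add 3 (S.d + 3) 2]; ring
  calc (2 * S.Nsub3 P I k + 1) * S.T3 P I
      ≤ (2 * (3 ^ (S.d + 3) * S.Xs3 P I) + 1) * S.T3 P I := by
        apply Nat.mul_le_mul_right; have := Nat.mul_le_mul_right (S.Xs3 P I) h3; omega
    _ = 2 * 3 ^ (S.d + 3) * (S.Xs3 P I * S.T3 P I) + S.T3 P I := by ring
    _ ≤ 2 * 3 ^ (S.d + 3) * (4 * P.X * P.L) + 4 * P.L := by gcongr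
    _ ≤ 3 ^ (S.d + 5) * (P.X * P.L) := by
        rw [e]
        have : 4 * P.L ≤ 3 ^ (S.d + 3) * (P.X * P.L) := by
          have h27 : 27 ≤ 3 ^ (S.d + 3) := by
            calc 27 = 3 ^ 3 := by norm_num
              _ ≤ 3 ^ (S.d + 3) := Nat.pow_le_pow_right (by norm_num) (by omega)
          have hXL : P.L ≤ P.X * P.L := Nat.le_mul_of_pos_left _ (by omega)
          calc 4 * P.L ≤ 27 * (P.X * P.L) := by omega
            _ ≤ 3 ^ (S.d + 3) * (P.X * P.L) := Nat.mul_le_mul_right _ h27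
        nlinarith

/-- **The third-step multiplicity from above**: `Tfin I − T0 (I+1) ≤ (d+3)·T3 I`. [folklore] -/
theorem t3_le (I : ℕ) : (S.schedTwoS P).Tfin I - (S.schedTwoS P).T0 (I + 1) ≤ (S.d + 3) * S.T3 P I := by
  rw [S.Tfin_schedTwoS_eq P I, schedTwoS_T0]
  unfold T03
  have e : S.d + 1 + 2 = S.d + 3 := by omega
  rw [e]
  omega

/-- **The node–multiplicity product of the third step**: `(2·Nfin I + 1)·t₃ ≤ (d+3)·3^{d+5}·X·L`.
[cite: Yu2013, (5.58); shape only] -/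
theorem nfin_mul_t3_le (I : ℕ) :
    (2 * (S.schedTwoS P).Nfin I + 1) * ((S.schedTwoS P).Tfin I - (S.schedTwoS P).T0 (I + 1)) ≤
      (S.d + 3) * (3 ^ (S.d + 5) * (P.X * P.L)) := by
  have ht := S.t3_le P I
  rw [schedTwoS_Nfin]
  have hXT := S.Xs3_mul_le_nat P I
  have hX : 1 ≤ P.X := le_trans (by norm_num) P.seventytwo_le_X'
  have hXs : S.Xs3 P I * S.T3 P I ≤ 4 * P.X * P.L := le_trans (Nat.mul_le_mul_left _ (Nat.le_succ _)) hXT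
  have hT : S.T3 P I ≤ 4 * P.L := by unfold T3; exact Nat.div_le_self _ _
  have e : 3 ^ (S.d + 5) = 9 * 3 ^ (S.d + 3) := by rw [pow_add 3 (S.d + 3) 2]; ring
  calc (2 * (3 ^ (S.d + 3) * S.Xs3 P I) + 1) * ((S.schedTwoS P).Tfin I - (S.schedTwoS P).T0 (I + 1))
      ≤ (2 * (3 ^ (S.d + 3) * S.Xs3 P I) + 1) * ((S.d + 3) * S.T3 P I) := Nat.mul_le_mul_left _ ht
    _ = (S.d + 3) * (2 * 3 ^ (S.d + 3) * (S.Xs3 P I * S.T3 P I) + S.T3 P I) := by ring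
    _ ≤ (S.d + 3) * (2 * 3 ^ (S.d + 3) * (4 * P.X * P.L) + 4 * P.L) := by gcongr
    _ ≤ (S.d + 3) * (3 ^ (S.d + 5) * (P.X * P.L)) := by
        apply Nat.mul_le_mul_left
        rw [e]
        have : 4 * P.L ≤ 3 ^ (S.d + 3) * (P.X * P.L) := by
          have h27 : 27 ≤ 3 ^ (S.d + 3) := by
            calc 27 = 3 ^ 3 := by norm_num
              _ ≤ 3 ^ (S.d + 3) := Nat.pow_le_pow_right (by norm_num) (by omega)
          have hXL : P.L ≤ P.X * P.L := Nat.le_mul_of_pos_left _ (by omega)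
          calc 4 * P.L ≤ 27 * (P.X * P.L) := by omega
            _ ≤ 3 ^ (S.d + 3) * (P.X * P.L) := Nat.mul_le_mul_right _ h27
        nlinarith

/-- **Level `0` (all nodes)**: the first-branch exponent of every sub-step is `≤ (m+6)·(d+3)·3^{d+5}·X·L`.
[cite: Yu2013, Lemma 5.1; shape only] -/
theorem kExpA_schedTwoS_le {k : ℕ} (hk : k < S.d + 3) :
    (S.schedTwoS P).tdec 0 + condExp 2 (2 * (S.schedTwoS P).Nsub 0 k + 1) ((S.schedTwoS P).tdec 0) +
        ((S.schedTwoS P).m + 2) * gainExpA (S.schedTwoS P) 0 k ≤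
      (P.m + 6) * ((S.d + 3) * (3 ^ (S.d + 5) * (P.X * P.L))) := by
  rw [schedTwoS_tdec, schedTwoS_Nsub, schedTwoS_m]
  have hg : gainExpA (S.schedTwoS P) 0 k ≤ (2 * S.Nsub3 P 0 k + 1) * S.T3 P 0 := by
    unfold gainExpA; rw [schedTwoS_Nsub, schedTwoS_tdec]
  have hB := S.nodes_mul_T3_le P 0 (k := k) (by omega)
  have hB' : (2 * S.Nsub3 P 0 k + 1) * S.T3 P 0 ≤ (S.d + 3) * (3 ^ (S.d + 5) * (P.X * P.L)) :=
    hB.trans (Nat.le_mul_of_pos_left _ (by omega))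
  exact first_exp_le hg hB'

/-- **Levels `I ≥ 1`**: `kExp σ I k ≤ (m+6)·(d+3)·3^{d+5}·X·L`. [cite: Yu2013, Lemma 5.1; shape only] -/
theorem kExp_schedTwoS_le (I : ℕ) {k : ℕ} (hk : k < S.d + 3) :
    kExp (S.schedTwoS P) I k ≤ (P.m + 6) * ((S.d + 3) * (3 ^ (S.d + 5) * (P.X * P.L))) := by
  unfold kExp
  rw [schedTwoS_tdec, schedTwoS_Nsub, schedTwoS_m]
  have hg : gainExp (S.schedTwoS P) I k ≤ (2 * S.Nsub3 P I k + 1) * S.T3 P I := by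
    have := gainExp_le (S.schedTwoS P) I k
    rw [schedTwoS_Nsub, schedTwoS_tdec] at this; exact this
  have hB := S.nodes_mul_T3_le P I (k := k) (by omega)
  have hB' : (2 * S.Nsub3 P I k + 1) * S.T3 P I ≤ (S.d + 3) * (3 ^ (S.d + 5) * (P.X * P.L)) :=
    hB.trans (Nat.le_mul_of_pos_left _ (by omega))
  exact first_exp_le hg hB'

/-- **Third steps**: `tExp σ I ≤ (m+6)·(d+3)·3^{d+5}·X·L`. [cite: Yu2013, Lemma 5.1 and (5.58); shape only] -/
theorem tExp_schedTwoS_le (I : ℕ) :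
    tExp (S.schedTwoS P) I ≤ (P.m + 6) * ((S.d + 3) * (3 ^ (S.d + 5) * (P.X * P.L))) := by
  unfold tExp
  rw [schedTwoS_m]
  exact first_exp_le le_rfl (S.nfin_mul_t3_le P I)

end TwoSetup

end Summit.ABC.StewartYu

end
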